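import Literature.NumberTheory.EllipticCurves.BinaryQuarticDiscriminantFpCountProofs
import Mathlib.Algebra.Module.ZMod
import Mathlib.Tactic
import HarnessLib

/-!
# The commutant of the squared transvections of `𝔽_p²` (`p` odd) is `𝔽_p`; subgroups stable under them are `⊥`/`⊤`

Helper file (THEOREMS ONLY: no definition, no named fact, no instance, no `sorry`; pure linear algebra over `ZMod p`) for
crux r205 stmt-BirchSwinnertonDyer-24737 `…Theses.UniversalToricDescent.TwinAlgMuZeroAtThree`, line `beta-road` (skeleton v10
cd44fe9d5c6b9a78), stub `stub_howardOutputsOfFamily` (K2_Howard ∣ β), E2 unit («H-twin»): the algebraic half of the SQUARES TRICK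
by which `…Theorems.UniversalToricDescentTwinSchurAtThree` derives Howard's hypothesis H.1 for the twin (`E′[3]` absolutely
irreducible over the imaginary quadratic `K`) from `ρ̄_{E′,3}` onto over `ℚ`: `ρ̄(Γ_K)` contains the square of every element of
`Aut E′[3] ≅ GL₂(𝔽₃)`, and

* `forall_eq_smul_of_forall_sq_comm_plane` — an additive endomorphism `ψ` of `(ℤ/p)²` commuting with `T ∘ T` for every additive
  automorphism `T` (used: the elementary transvections `(1 1; 0 1)`, `(1 0; 1 1)`, `exists_addEquiv_transvection_fst/snd`, whose
  squares are `(1 2; 0 1)`, `(1 0; 2 1)`) is the scalar `(ψ δ₀)₀` (`2 ∈ 𝔽_pˣ` for `p` odd; a two-line matrix computation);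
* `eq_bot_or_eq_top_of_forall_sq_stable_plane` — a subgroup of `(ℤ/p)²` stable under those squares is `⊥` or `⊤`;
* `exists_forall_eq_zsmul_of_forall_sq_comm`, `eq_bot_or_eq_top_of_forall_sq_stable` — the same for any abelian group `V` with a
  frame `V ≃+ (ℤ/p)²`, the scalar read as an INTEGER multiple (the currency of the tree's `hschur` binders).

Group-theoretic background: for `p` odd `[GL₂(𝔽_p), GL₂(𝔽_p)] = SL₂(𝔽_p)` is generated by transvections and acts absolutely
irreducibly (Serre 1972 §2; Lang, *Algebra* XIII §8–9); only the two squared transvections are needed here.  «beyond-print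
theorem»: no (textbook).  BSD is NOT proved by this file; 24737 stays OPEN.

References: J.-P. Serre, Invent. Math. 15 (1972), §2 [Serre1972]; S. Lang, *Algebra*, Ch. XIII §8 and Ch. XVII §1 [Lang2002].
-/

set_option autoImplicit false
set_option linter.dupNamespace false

noncomputable section

namespace Summit.BirchSwinnertonDyer.BirchSwinnertonDyer.Theorems.UniversalToricDescentSquaresCommutantPlane

/-! ### §1 The plane `𝔽_p²`: two transvections, the commutant of their squares, stable subgroups -/

section Plane

variable {p : ℕ} [hp : Fact p.Prime]

/-- The elementary transvection `(x₀, x₁) ↦ (x₀ + x₁, x₁)` of `(ℤ/p)²` as an additive automorphism (matrix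
`(1 1; 0 1)`). [folklore] -/
theorem exists_addEquiv_transvection_fst :
    ∃ T : (Fin 2 → ZMod p) ≃+ (Fin 2 → ZMod p), ∀ x, T x 0 = x 0 + x 1 ∧ T x 1 = x 1 := by
  refine ⟨{ toFun := fun x i ↦ if i = 0 then x 0 + x 1 else x 1,
            invFun := fun y i ↦ if i = 0 then y 0 - y 1 else y 1,
            left_inv := fun x ↦ ?_,
            right_inv := fun y ↦ ?_,
            map_add' := fun x y ↦ ?_ }, fun x ↦ ⟨?_, ?_⟩⟩
  · funext i
    fin_cases i
    · simp only [Fin.zero_eta, Fin.isValue, if_true, one_ne_zero, if_false, add_sub_cancel_right]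
    · simp only [Fin.mk_one, Fin.isValue, one_ne_zero, if_false]
  · funext i
    fin_cases i
    · simp only [Fin.zero_eta, Fin.isValue, if_true, one_ne_zero, if_false, sub_add_cancel]
    · simp only [Fin.mk_one, Fin.isValue, one_ne_zero, if_false]
  · funext i
    fin_cases i
    · simp only [Fin.zero_eta, Fin.isValue, if_true, Pi.add_apply]; ring
    · simp only [Fin.mk_one, Fin.isValue, one_ne_zero, if_false, Pi.add_apply]
  · simp only [AddEquiv.coe_mk, Equiv.coe_fn_mk, Fin.isValue, if_true]
  · simp only [AddEquiv.coe_mk, Equiv.coe_fn_mk, Fin.isValue, one_ne_zero, if_false]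

/-- The elementary transvection `(x₀, x₁) ↦ (x₀, x₀ + x₁)` of `(ℤ/p)²` (matrix `(1 0; 1 1)`). [folklore] -/
theorem exists_addEquiv_transvection_snd :
    ∃ T : (Fin 2 → ZMod p) ≃+ (Fin 2 → ZMod p), ∀ x, T x 0 = x 0 ∧ T x 1 = x 0 + x 1 := by
  refine ⟨{ toFun := fun x i ↦ if i = 0 then x 0 else x 0 + x 1,
            invFun := fun y i ↦ if i = 0 then y 0 else y 1 - y 0,
            left_inv := fun x ↦ ?_,
            right_inv := fun y ↦ ?_,
            map_add' := fun x y ↦ ?_ }, fun x ↦ ⟨?_, ?_⟩⟩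
  · funext i
    fin_cases i
    · simp only [Fin.zero_eta, Fin.isValue, if_true]
    · simp only [Fin.mk_one, Fin.isValue, one_ne_zero, if_false, if_true, add_sub_cancel_left]
  · funext i
    fin_cases i
    · simp only [Fin.zero_eta, Fin.isValue, if_true]
    · simp only [Fin.mk_one, Fin.isValue, one_ne_zero, if_false, if_true, add_sub_cancel]
  · funext i
    fin_cases i
    · simp only [Fin.zero_eta, Fin.isValue, if_true, Pi.add_apply]
    · simp only [Fin.mk_one, Fin.isValue, one_ne_zero, if_false, Pi.add_apply]; ring
  · simp only [AddEquiv.coe_mk, Equiv.coe_fn_mk, Fin.isValue, if_true]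
  · simp only [AddEquiv.coe_mk, Equiv.coe_fn_mk, Fin.isValue, one_ne_zero, if_false]

/-- Every vector of `(ℤ/p)²` in the frame `δ₀ = (1,0)`, `δ₁ = (0,1)`: `y = y₀ δ₀ + y₁ δ₁`. [folklore] -/
theorem eq_smul_single_add_smul_single (y : Fin 2 → ZMod p) :
    y = y 0 • (Pi.single 0 1 : Fin 2 → ZMod p) + y 1 • (Pi.single 1 1 : Fin 2 → ZMod p) := by
  funext i
  fin_cases i <;> simp

/-- **The commutant of the two squared transvections is `𝔽_p` (`p` odd).** An additive endomorphism `ψ` of `(ℤ/p)²`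
commuting with `T ∘ T` for EVERY additive automorphism `T` (only `(1 2; 0 1)` and `(1 0; 2 1)` are used) is
multiplication by the scalar `a = (ψ δ₀)₀`: `ψ y = a • y`.  (Matrix computation: `[ψ, (1 2; 0 1)] = 0` forces
`ψ₁₀ = 0`, `ψ₀₀ = ψ₁₁`; `[ψ, (1 0; 2 1)] = 0` forces `ψ₀₁ = 0`; `2 ∈ 𝔽_pˣ`.) [folklore] -/
theorem forall_eq_smul_of_forall_sq_comm_plane (hp2 : p ≠ 2)
    (ψ : (Fin 2 → ZMod p) →+ (Fin 2 → ZMod p))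
    (hψ : ∀ (T : (Fin 2 → ZMod p) ≃+ (Fin 2 → ZMod p)) (y : Fin 2 → ZMod p), ψ (T (T y)) = T (T (ψ y))) :
    ∀ y : Fin 2 → ZMod p, ψ y = (ψ (Pi.single 0 1) 0) • y := by
  have h2 := Literature.NumberTheory.EllipticCurves.BinaryQuartic.two_ne_zero_zmod hp2
  obtain ⟨T₁, hT₁⟩ := exists_addEquiv_transvection_fst (p := p)
  obtain ⟨T₂, hT₂⟩ := exists_addEquiv_transvection_snd (p := p)
  set δ₀ : Fin 2 → ZMod p := Pi.single 0 1 with hδ₀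
  set δ₁ : Fin 2 → ZMod p := Pi.single 1 1 with hδ₁
  -- the ZMod p-linear version of `ψ`
  let L : (Fin 2 → ZMod p) →ₗ[ZMod p] (Fin 2 → ZMod p) := ψ.toZModLinearMap p
  have hL : ∀ y, L y = ψ y := fun y ↦ rfl
  -- squares of the transvections on vectors
  have hT₁sq : ∀ y, T₁ (T₁ y) 0 = y 0 + 2 * y 1 ∧ T₁ (T₁ y) 1 = y 1 := fun y ↦ by
    refine ⟨?_, ?_⟩
    · rw [(hT₁ _).1, (hT₁ y).1, (hT₁ y).2]; ring
    · rw [(hT₁ _).2, (hT₁ y).2]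
  have hT₂sq : ∀ y, T₂ (T₂ y) 0 = y 0 ∧ T₂ (T₂ y) 1 = 2 * y 0 + y 1 := fun y ↦ by
    refine ⟨?_, ?_⟩
    · rw [(hT₂ _).1, (hT₂ y).1]
    · rw [(hT₂ _).2, (hT₂ y).1, (hT₂ y).2]; ring
  have hT₁δ₁ : T₁ (T₁ δ₁) = (2 : ZMod p) • δ₀ + δ₁ := by
    funext i
    fin_cases i
    · rw [show ((⟨0, by norm_num⟩ : Fin 2)) = 0 from rfl, (hT₁sq δ₁).1]
      simp [hδ₀, hδ₁]
    · rw [show ((⟨1, by norm_num⟩ : Fin 2)) = 1 from rfl, (hT₁sq δ₁).2]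
      simp [hδ₀, hδ₁]
  have hT₂δ₀ : T₂ (T₂ δ₀) = δ₀ + (2 : ZMod p) • δ₁ := by
    funext i
    fin_cases i
    · rw [show ((⟨0, by norm_num⟩ : Fin 2)) = 0 from rfl, (hT₂sq δ₀).1]
      simp [hδ₀, hδ₁]
    · rw [show ((⟨1, by norm_num⟩ : Fin 2)) = 1 from rfl, (hT₂sq δ₀).2]
      simp [hδ₀, hδ₁]
  -- the three matrix-entry relations
  have e1 := hψ T₁ δ₁
  rw [hT₁δ₁, ← hL, map_add, map_smul, hL, hL] at e1
  have e1₀ := congrFun e1 0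
  have e1₁ := congrFun e1 1
  rw [(hT₁sq _).1] at e1₀
  rw [(hT₁sq _).2] at e1₁
  simp only [Pi.add_apply, Pi.smul_apply, smul_eq_mul] at e1₀ e1₁
  have e2 := hψ T₂ δ₀
  rw [hT₂δ₀, ← hL, map_add, map_smul, hL, hL] at e2
  have e2₀ := congrFun e2 0
  rw [(hT₂sq _).1] at e2₀
  simp only [Pi.add_apply, Pi.smul_apply, smul_eq_mul] at e2₀
  -- solve: ψ δ₀ 1 = 0, ψ δ₁ 0 = 0, ψ δ₁ 1 = ψ δ₀ 0
  have hc : ψ δ₀ 1 = 0 := by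
    have h : 2 * ψ δ₀ 1 = 0 := by linear_combination e1₁
    exact (mul_eq_zero.mp h).resolve_left h2
  have hb : ψ δ₁ 0 = 0 := by
    have h : 2 * ψ δ₁ 0 = 0 := by linear_combination e2₀
    exact (mul_eq_zero.mp h).resolve_left h2
  have hd : ψ δ₁ 1 = ψ δ₀ 0 := by
    have h : 2 * (ψ δ₁ 1 - ψ δ₀ 0) = 0 := by linear_combination -e1₀
    exact (sub_eq_zero.mp ((mul_eq_zero.mp h).resolve_left h2))
  -- conclude coordinatewise
  intro y
  have hy := eq_smul_single_add_smul_single y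
  rw [← hδ₀, ← hδ₁] at hy
  have hLy : ψ y = y 0 • ψ δ₀ + y 1 • ψ δ₁ := by
    conv_lhs => rw [hy]
    rw [← hL, map_add, map_smul, map_smul, hL, hL]
  funext i
  rw [hLy]
  fin_cases i
  · rw [show ((⟨0, by norm_num⟩ : Fin 2)) = 0 from rfl]
    simp only [Pi.add_apply, Pi.smul_apply, smul_eq_mul, hb]
    ring
  · rw [show ((⟨1, by norm_num⟩ : Fin 2)) = 1 from rfl]
    simp only [Pi.add_apply, Pi.smul_apply, smul_eq_mul, hc, hd]
    ring

/-- **A subgroup of `(ℤ/p)²` stable under the two squared transvections is `⊥` or `⊤` (`p` odd).** If `H` is stable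
under `T ∘ T` for EVERY additive automorphism `T` (only `(1 2; 0 1)` and `(1 0; 2 1)` are used) and `y ∈ H ∖ 0`, then
`(T₁² − 1) y = 2y₁ δ₀ ∈ H` and `(T₂² − 1) y = 2y₀ δ₁ ∈ H`; one of `y₀, y₁` is non-zero, so one of `δ₀, δ₁` lies in `H`,
and then the other one does too (`(T₂² − 1) δ₀ = 2 δ₁`, `(T₁² − 1) δ₁ = 2 δ₀`, `2 ∈ 𝔽_pˣ`). [folklore] -/
theorem eq_bot_or_eq_top_of_forall_sq_stable_plane (hp2 : p ≠ 2)
    (H : AddSubgroup (Fin 2 → ZMod p))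
    (hH : ∀ (T : (Fin 2 → ZMod p) ≃+ (Fin 2 → ZMod p)), ∀ y ∈ H, T (T y) ∈ H) :
    H = ⊥ ∨ H = ⊤ := by
  have h2 := Literature.NumberTheory.EllipticCurves.BinaryQuartic.two_ne_zero_zmod hp2
  obtain ⟨T₁, hT₁⟩ := exists_addEquiv_transvection_fst (p := p)
  obtain ⟨T₂, hT₂⟩ := exists_addEquiv_transvection_snd (p := p)
  set δ₀ : Fin 2 → ZMod p := Pi.single 0 1 with hδ₀
  set δ₁ : Fin 2 → ZMod p := Pi.single 1 1 with hδ₁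
  by_cases hbot : H = ⊥
  · exact Or.inl hbot
  right
  obtain ⟨y, hyH, hy0⟩ : ∃ y ∈ H, y ≠ 0 := by
    by_contra hne
    push Not at hne
    exact hbot ((AddSubgroup.eq_bot_iff_forall H).mpr hne)
  -- `(T₁² − 1) z = 2 z₁ δ₀`, `(T₂² − 1) z = 2 z₀ δ₁`
  have hT₁sub : ∀ z, T₁ (T₁ z) - z = (2 * z 1) • δ₀ := fun z ↦ by
    funext i
    fin_cases i
    · rw [show ((⟨0, by norm_num⟩ : Fin 2)) = 0 from rfl, Pi.sub_apply, (hT₁ _).1, (hT₁ z).1, (hT₁ z).2]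
      simp [hδ₀]; ring
    · rw [show ((⟨1, by norm_num⟩ : Fin 2)) = 1 from rfl, Pi.sub_apply, (hT₁ _).2, (hT₁ z).2]
      simp [hδ₀]
  have hT₂sub : ∀ z, T₂ (T₂ z) - z = (2 * z 0) • δ₁ := fun z ↦ by
    funext i
    fin_cases i
    · rw [show ((⟨0, by norm_num⟩ : Fin 2)) = 0 from rfl, Pi.sub_apply, (hT₂ _).1, (hT₂ z).1]
      simp [hδ₁]
    · rw [show ((⟨1, by norm_num⟩ : Fin 2)) = 1 from rfl, Pi.sub_apply, (hT₂ _).2, (hT₂ z).1, (hT₂ z).2]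
      simp [hδ₁]; ring
  have hmem₁ : ∀ z ∈ H, (2 * z 1) • δ₀ ∈ H := fun z hz ↦ by
    rw [← hT₁sub]; exact H.sub_mem (hH T₁ z hz) hz
  have hmem₂ : ∀ z ∈ H, (2 * z 0) • δ₁ ∈ H := fun z hz ↦ by
    rw [← hT₂sub]; exact H.sub_mem (hH T₂ z hz) hz
  -- unscale by a unit of `𝔽_p`
  have hunit : ∀ (c : ZMod p) (v : Fin 2 → ZMod p), c ≠ 0 → c • v ∈ H → v ∈ H := fun c v hc hcv ↦ by
    have h := ZMod.smul_mem (K := H) hcv c⁻¹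
    rwa [smul_smul, inv_mul_cancel₀ hc, one_smul] at h
  have hδ₀₁ : δ₀ 1 = 0 := by simp [hδ₀]
  have hδ₀₀ : δ₀ 0 = 1 := by simp [hδ₀]
  have hδ₁₀ : δ₁ 0 = 0 := by simp [hδ₁]
  have hδ₁₁ : δ₁ 1 = 1 := by simp [hδ₁]
  -- from one basis vector to the other
  have h01 : δ₀ ∈ H → δ₁ ∈ H := fun h0 ↦ by
    have h := hmem₂ δ₀ h0
    rw [hδ₀₀, mul_one] at h
    exact hunit 2 δ₁ h2 h
  have h10 : δ₁ ∈ H → δ₀ ∈ H := fun h1 ↦ by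
    have h := hmem₁ δ₁ h1
    rw [hδ₁₁, mul_one] at h
    exact hunit 2 δ₀ h2 h
  -- both basis vectors lie in `H`
  have hboth : δ₀ ∈ H ∧ δ₁ ∈ H := by
    by_cases hy1 : y 1 = 0
    · have hy0' : y 0 ≠ 0 := by
        intro hy00
        apply hy0
        rw [eq_smul_single_add_smul_single y, hy00, hy1, zero_smul, zero_smul, add_zero]
      have h := hmem₂ y hyH
      have hδ₁H : δ₁ ∈ H := hunit (2 * y 0) δ₁ (mul_ne_zero h2 hy0') h
      exact ⟨h10 hδ₁H, hδ₁H⟩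
    · have h := hmem₁ y hyH
      have hδ₀H : δ₀ ∈ H := hunit (2 * y 1) δ₀ (mul_ne_zero h2 hy1) h
      exact ⟨hδ₀H, h01 hδ₀H⟩
  rw [eq_top_iff]
  intro z _
  rw [eq_smul_single_add_smul_single z, ← hδ₀, ← hδ₁]
  exact H.add_mem (ZMod.smul_mem (K := H) hboth.1 _) (ZMod.smul_mem (K := H) hboth.2 _)

end Plane

/-! ### §2 A group `V` with a frame `V ≃ (ℤ/p)²` -/

section Framed

variable {p : ℕ} [hp : Fact p.Prime] {V : Type*} [AddCommGroup V]

/-- **Schur for a framed `𝔽_p`-plane (`p` odd).** If `V ≃ (ℤ/p)²` and an additive endomorphism `φ` of `V` commutes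
with the square `u ∘ u` of EVERY additive automorphism `u` of `V`, then `φ` is multiplication by an integer.
[folklore] -/
theorem exists_forall_eq_zsmul_of_forall_sq_comm (hp2 : p ≠ 2) (e : V ≃+ (Fin 2 → ZMod p))
    (φ : V →+ V) (hφ : ∀ (u : V ≃+ V) (x : V), φ (u (u x)) = u (u (φ x))) :
    ∃ c : ℤ, ∀ x : V, φ x = c • x := by
  haveI : NeZero p := ⟨hp.out.ne_zero⟩
  -- transport `φ` to the plane
  set ψ : (Fin 2 → ZMod p) →+ (Fin 2 → ZMod p) :=
    (e : V →+ (Fin 2 → ZMod p)).comp (φ.comp (e.symm : (Fin 2 → ZMod p) →+ V)) with hψdef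
  have hψapply : ∀ y, ψ y = e (φ (e.symm y)) := fun y ↦ rfl
  have hψ : ∀ (T : (Fin 2 → ZMod p) ≃+ (Fin 2 → ZMod p)) (y : Fin 2 → ZMod p),
      ψ (T (T y)) = T (T (ψ y)) := by
    intro T y
    have h := hφ (e.trans (T.trans e.symm)) (e.symm y)
    simp only [AddEquiv.trans_apply, AddEquiv.apply_symm_apply] at h
    rw [hψapply, hψapply, h, AddEquiv.apply_symm_apply]
  have hall := forall_eq_smul_of_forall_sq_comm_plane hp2 ψ hψ
  refine ⟨((ψ (Pi.single 0 1) 0).val : ℤ), fun x ↦ ?_⟩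
  have h := hall (e x)
  rw [hψapply, AddEquiv.symm_apply_apply] at h
  apply e.injective
  rw [h, natCast_zsmul, map_nsmul, ← Nat.cast_smul_eq_nsmul (ZMod p), ZMod.natCast_zmod_val]

/-- **Irreducibility for a framed `𝔽_p`-plane (`p` odd).** If `V ≃ (ℤ/p)²` and a subgroup `H ≤ V` is stable under the
square `u ∘ u` of EVERY additive automorphism `u` of `V`, then `H = ⊥` or `H = ⊤`. [folklore] -/
theorem eq_bot_or_eq_top_of_forall_sq_stable (hp2 : p ≠ 2) (e : V ≃+ (Fin 2 → ZMod p))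
    (H : AddSubgroup V) (hH : ∀ (u : V ≃+ V), ∀ x ∈ H, u (u x) ∈ H) : H = ⊥ ∨ H = ⊤ := by
  set H' : AddSubgroup (Fin 2 → ZMod p) := H.map (e : V →+ (Fin 2 → ZMod p)) with hH'def
  have hmem : ∀ y, y ∈ H' ↔ e.symm y ∈ H := by
    intro y
    constructor
    · rintro ⟨x, hx, rfl⟩
      change e.symm (e x) ∈ H
      rwa [AddEquiv.symm_apply_apply]
    · intro hy
      exact ⟨e.symm y, hy, e.apply_symm_apply y⟩
  have hH' : ∀ (T : (Fin 2 → ZMod p) ≃+ (Fin 2 → ZMod p)), ∀ y ∈ H', T (T y) ∈ H' := by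
    intro T y hy
    rw [hmem] at hy ⊢
    have h := hH (e.trans (T.trans e.symm)) (e.symm y) hy
    simpa only [AddEquiv.trans_apply, AddEquiv.apply_symm_apply] using h
  rcases eq_bot_or_eq_top_of_forall_sq_stable_plane hp2 H' hH' with h | h
  · left
    rw [AddSubgroup.eq_bot_iff_forall] at h ⊢
    intro x hx
    have hx' : e x = 0 := h (e x) ⟨x, hx, rfl⟩
    apply e.injective
    rw [hx', map_zero]
  · right
    rw [eq_top_iff]
    intro x _
    have hx : e x ∈ H' := h ▸ AddSubgroup.mem_top _
    rw [hmem, AddEquiv.symm_apply_apply] at hx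
    exact hx

end Framed

end Summit.BirchSwinnertonDyer.BirchSwinnertonDyer.Theorems.UniversalToricDescentSquaresCommutantPlane

end
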